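import Summits.BirchSwinnertonDyer.BirchSwinnertonDyer.Theorems.GenusKolyvaginAtTwoGenusDeepSupplyAtTwoNegDiscNarrowDepthZeroLocalKummerReading
import Summits.BirchSwinnertonDyer.BirchSwinnertonDyer.Theorems.GenusKolyvaginAtTwoGenusDeepSupplyAtTwoNegDiscNarrowDepthZeroStrictTwinClasses
import Literature.NumberTheory.EllipticCurves.OpenImageMazurTwistProofs
import Literature.NumberTheory.EllipticCurves.QuadraticTwistSelmerPInfty
import HarnessLib

/-!
# Route `GenusKolyvaginAtTwo`, crux `GenusDeepSupplyAtTwoNegDiscNarrow` (stmt-BirchSwinnertonDyer-23491): THE TWISTED LOCAL READING —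
# a twin point with non-zero local Kummer class at `ℓ` does NOT reduce to `Õ` on the curve at any prime above `ℓ`

Width seat `bsd-line-gk2-p4` g25 (cell `bsd-f1-sign2`), `--supports stmt-BirchSwinnertonDyer-23491` (helper; closes nothing).
THEOREMS ONLY (no definition, no named fact, no `sorry`); **BSD is NOT proved by any of this; no item is closed.**

CONTEXT. Third file of Claim B of the LEAD's depth-zero reduction criterion (memo `DEPTH-ZERO-REDUCTION-CRITERION-g21.md` §2).
The global half (`…DepthZeroStrictTwinClasses`, p763963: on the `#Sel₂(E) = 1` cell a twin point `z ∈ Wd(ℚ)` with `κ(z) ≠ 0` has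
`loc_{ℓ₀} κ(z) ≠ 0`) and the local plumbing (`…DepthZeroLocalKummerReading`, p764224: `loc_v κ = 0 ⟺` a root fixed by the
decomposition group; the kernel half at a good prime) are assembled here through a SIGNED TWIST ISOMORPHISM
`F : Wd(ℚ̄) ≃+ W(ℚ̄)` (`F(σP) = ±σF(P)`, the sign depending on `σ` only — *AEC* X.5 Cor. 5.4; tree
`exists_addEquiv_geomPoints_quadraticTwist_signed`, here composed with the model isomorphism `twistPointsIso`):

* §1 `geomReduction_twist_ne_zero_of_localization_ne_zero` — FRAME-FREE: `W/ℚ` globally minimal, `ℓ ≠ 2` a prime of good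
  reduction, `Wd` ANY curve with a signed isomorphism `F`, `z ∈ Wd(ℚ)`: **`loc_ℓ κ₂(z) ≠ 0 ⟹ red_𝔓(F z̃) ≠ Õ`** (`z̃ = z` in `Wd(ℚ̄)`,
  `red_𝔓 = geomReduction` along the tree's place over `ℓ`). Proof: if `red(F z̃) = Õ`, the kernel half `R₀` of `F z̃` is fixed by
  the elements of `D_𝔓` fixing `F z̃` and negated by those negating it; as `z` is rational, `σ(F z̃) = ±F z̃` with the sign of `F` at
  `σ`, so `F⁻¹ R₀` is a `D_𝔓`-fixed half of `z̃`, i.e. `loc_ℓ κ(z) = 0`.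
* §2 `exists_signed_twistIso` — a signed `F` exists for every model `C • W^{(d)} = Wd`.
* §3 ON THE CELL (`Δ_W < 0`, `K` imaginary quadratic with `d_K = −ℓ`, Heegner, `#Sel₂(W) = 1`, `Wd` a model of the twin):
  **`geomReduction_twist_ne_zero_of_kummer_ne_zero_of_selmerTrivial_prime`: `κ(z) ≠ 0 ⟹ red_𝔓(F z̃) ≠ Õ`** — Claim B up to the
  identification `F z̃ = e_*(y_K − s)` of the twin Heegner point with the anti-invariant part of `y_K` (the remaining E(K)-side step
  towards the R₁ currency of `DepthZero.nonCMAtTwo_of_items_of_reductionBits`, NOT done here).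

References: [SilvermanAEC2009] X.5 Cor. 5.4, X.2 Prop. 2.4, VIII §2, VII.3.1; [MazurRubin2010] Prop. 3.3; [GrossLMS1991] §5 Prop. 5.3;
[NeukirchANT1999] II §9 (9.6).
-/

set_option linter.dupNamespace false -- tree convention: `Summit.BirchSwinnertonDyer.BirchSwinnertonDyer.Theorems` (summit = sub-problem)
set_option autoImplicit false

noncomputable section

open scoped Classical Pointwise

namespace Summit.BirchSwinnertonDyer.BirchSwinnertonDyer.Theorems.GenusSupplyNarrow.DepthZero

open WeierstrassCurve Field NumberField IsDedekindDomain Function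
open Literature.NumberTheory.EllipticCurves Literature.NumberTheory.GaloisRepresentations
open Literature.NumberTheory.GaloisCohomology
open Rat.HeightOneSpectrum (primesEquiv natGenerator)
open Summit.BirchSwinnertonDyer.BirchSwinnertonDyer.Theorems.GenusKolyArch (hdiv_two)
open Summit.BirchSwinnertonDyer.BirchSwinnertonDyer.Theorems.GenusKolyTwistingPrime (primesEquiv_eq)

/-! ## §1 The twisted local reading (frame-free) -/

section TwistedReading

variable {W : WeierstrassCurve ℚ} [W.IsGloballyMinimal] [W.IsElliptic] {Wd : WeierstrassCurve ℚ}

omit [W.IsGloballyMinimal] [W.IsElliptic] in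
/-- **A rational point is Galois-fixed in `Wd(ℚ̄)`; through a signed isomorphism its image is an EIGENVECTOR of every `σ`**:
`σ • F z̃ = F z̃` when `F` commutes with `σ`, `σ • F z̃ = −F z̃` when it anticommutes. [cite: SilvermanAEC2009, X.5 Cor. 5.4] -/
theorem smul_twist_toGeomPoints (F : Wd.geomPoints ≃+ W.geomPoints) (σ : absoluteGaloisGroup ℚ) (z : Wd.toAffine.Point) :
    ((∀ P, F (σ • P) = σ • F P) → σ • F (toGeomPoints Wd z) = F (toGeomPoints Wd z)) ∧
    ((∀ P, F (σ • P) = -(σ • F P)) → σ • F (toGeomPoints Wd z) = -F (toGeomPoints Wd z)) := by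
  have hz : σ • toGeomPoints Wd z = toGeomPoints Wd z := toGeomPoints_mem_fixedPoints Wd z σ
  refine ⟨fun hpos ↦ by rw [← hpos, hz], fun hneg ↦ ?_⟩
  have h := hneg (toGeomPoints Wd z)
  rw [hz] at h
  exact (neg_eq_iff_eq_neg.mpr h).symm

/-- **THE TWISTED LOCAL READING.** `W/ℚ` globally minimal elliptic, `ℓ ≠ 2` a prime with `ℓ ∤ Δ_min(W)`, `v` the place of `ℚ` over
`ℓ`, `Wd` any elliptic curve over `ℚ` with a SIGNED additive isomorphism `F : Wd(ℚ̄) ≃+ W(ℚ̄)` (`F(σP) = σF(P)` for all `P`, or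
`F(σP) = −σF(P)` for all `P`, for each `σ ∈ Γ_ℚ`), `z ∈ Wd(ℚ)` with `loc_v κ₂(z) ≠ 0` (not halvable in `Wd(ℚ_ℓ)`). THEN `F z̃` does NOT
reduce to `Õ` under `red_𝔓 = geomReduction : E(ℚ̄) → Ẽ(𝔽̄_ℓ)`. Proof: otherwise the kernel half `R₀` of `F z̃` (`2R₀ = F z̃`,
`red R₀ = Õ`) is fixed by every `σ ∈ D_𝔓` fixing `F z̃` and negated by every `σ ∈ D_𝔓` negating it; `z` being rational, `σ(F z̃) = ±F z̃`
with the sign of `F` at `σ`, whence `F⁻¹R₀` is a `D_𝔓`-fixed half of `z̃` and `loc_v κ₂(z) = 0`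
(`localization_kummerMapTorsion_eq_zero_iff_exists_root_fixed_of_mem_primesAbove`). [cite: SilvermanAEC2009, X.5 Cor. 5.4, VIII §2,
Prop. VII.3.1(b)] [cite: NeukirchANT1999, Ch. II §9 Prop. (9.6)] -/
theorem geomReduction_twist_ne_zero_of_localization_ne_zero (F : Wd.geomPoints ≃+ W.geomPoints)
    (hF : ∀ σ : absoluteGaloisGroup ℚ, (∀ P, F (σ • P) = σ • F P) ∨ (∀ P, F (σ • P) = -(σ • F P)))
    {ℓ : ℕ} [Fact ℓ.Prime] (hℓ2 : ℓ ≠ 2) (hΔ : ¬ (ℓ : ℤ) ∣ minimalDiscriminantInt W)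
    {v : HeightOneSpectrum (𝓞 ℚ)} (hv : ((primesEquiv v : Nat.Primes) : ℕ) = ℓ) (z : Wd.toAffine.Point)
    (hloc : galoisCohomology.localization (Wd.torsionGaloisModule ((2 : ℕ) : ℤ)) (Sum.inr v) 1
      (kummerMapTorsion Wd ((2 : ℕ) : ℤ) (hdiv_two Wd) z) ≠ 0) :
    geomReduction hΔ (F (toGeomPoints Wd z)) ≠ 0 := by
  intro hred
  -- the prime of `\bar ℤ` of the place, and the kernel half of `F z̃`
  obtain ⟨𝔓, hmem, h𝔓⟩ := exists_ideal_placeOver ℓ hv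
  obtain ⟨R₀, hR₀, hred₀⟩ := exists_half_geomReduction_eq_zero hΔ hℓ2 hred
  apply hloc
  rw [localization_kummerMapTorsion_eq_zero_iff_exists_root_fixed_of_mem_primesAbove Wd _ (hdiv_two Wd) v z h𝔓]
  refine ⟨F.symm R₀, ?_, fun σ hσ ↦ ?_⟩
  · apply F.injective
    rw [map_zsmul, F.apply_symm_apply, Nat.cast_ofNat, hR₀]
  · obtain ⟨hfix, hanti⟩ := smul_twist_toGeomPoints F σ z
    apply F.injective
    rcases hF σ with hpos | hneg
    · rw [hpos, F.apply_symm_apply]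
      exact smul_kernelHalf_eq_of_smul_eq hΔ hℓ2 hmem hσ hR₀ hred₀ (hfix hpos)
    · rw [hneg, F.apply_symm_apply, smul_kernelHalf_eq_neg_of_smul_eq_neg hΔ hℓ2 hmem hσ hR₀ hred₀ (hanti hneg), neg_neg]

end TwistedReading

/-! ## §2 A signed twist isomorphism exists for every model of the twist -/

/-- **Signed isomorphism `Wd(ℚ̄) ≃+ W(ℚ̄)` for a model `C • W^{(d)} = Wd`**: the tree's signed untwisting
`W^{(d)}(K̄) ≃+ W(K̄)` (*AEC* X.5 Cor. 5.4: `f(σP) = ±σf(P)` according as `σ√d = ±√d`) precomposed with the `Γ`-equivariant model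
isomorphism `twistPointsIso`. Stated over any field with `2 ≠ 0`. [cite: SilvermanAEC2009, X.5 Cor. 5.4 and X.2 Prop. 2.4] -/
theorem exists_signed_twistIso {K : Type} [Field K] [NeZero (2 : K)] (V : WeierstrassCurve K) {d : K} (hd : d ≠ 0)
    {Vd : WeierstrassCurve K} {C : VariableChange K} (hVd : C • V.quadraticTwist d = Vd) :
    ∃ F : Vd.geomPoints ≃+ V.geomPoints,
      ∀ σ : absoluteGaloisGroup K, (∀ P, F (σ • P) = σ • F P) ∨ (∀ P, F (σ • P) = -(σ • F P)) := by
  obtain ⟨f, hf⟩ := V.exists_addEquiv_geomPoints_quadraticTwist_signed hd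
  refine ⟨(twistPointsIso hVd).symm.trans f, fun σ ↦ ?_⟩
  have htw : ∀ Q : Vd.geomPoints, (twistPointsIso hVd).symm (σ • Q) = σ • (twistPointsIso hVd).symm Q := fun Q ↦ by
    apply (twistPointsIso hVd).injective
    rw [AddEquiv.apply_symm_apply, twistPointsIso_smul, AddEquiv.apply_symm_apply]
  rcases hf σ with hpos | hneg
  · exact Or.inl fun P ↦ by rw [AddEquiv.trans_apply, AddEquiv.trans_apply, htw, hpos]
  · exact Or.inr fun P ↦ by rw [AddEquiv.trans_apply, AddEquiv.trans_apply, htw, hneg]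

/-! ## §3 On the `#Sel₂(W) = 1` cell of the prime Heegner twin: `κ(z) ≠ 0 ⟹ red_𝔓(F z̃) ≠ Õ` -/

section Cell

variable (W : WeierstrassCurve ℚ) [W.IsElliptic] [W.IsGloballyMinimal]

/-- **CLAIM B, TWISTED GEOMETRIC FORM.** `W/ℚ` globally minimal elliptic with `Δ_W < 0`, `K` imaginary quadratic with `d_K = −ℓ`
(`ℓ` an odd prime — then `ℓ ∤ Δ_min(W)`: the primes of `N_W` split, `ℓ` ramifies), Heegner for `N_W`, `Wd` any elliptic model of
`W^{(d_K)}`, `F : Wd(ℚ̄) ≃+ W(ℚ̄)` any signed isomorphism, `#Sel₂(W) = 1`. For `z ∈ Wd(ℚ)` with `κ(z) ≠ 0` (`z ∉ 2Wd(ℚ)`):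
**`red_𝔓(F z̃) ≠ Õ`** at the place over `ℓ` — the global half (`…StrictTwinClasses`: `loc_ℓ κ(z) ≠ 0`) fed into §1. For the cell:
with `F z̃ = e_*(y_K − s)` this is «`M₀ = 0 ⟹ red_{λ₀}(y′) ≠ Õ`» of the LEAD's memo §2 (Claim B).
[cite: MazurRubin2010, Prop. 3.3, Cor. 3.4 (i)] [cite: SilvermanAEC2009, X.5 Cor. 5.4, VIII §2, VII.3.1] [cite: GrossLMS1991, §5 Prop. 5.3] -/
theorem geomReduction_twist_ne_zero_of_kummer_ne_zero_of_selmerTrivial_prime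
    {K : Type} [Field K] [NumberField K] (hΔneg : W.Δ < 0) (hK : IsImaginaryQuadratic K)
    (hH : SatisfiesHeegnerHypothesis (W.conductorNorm ℤ) K) {ℓ : ℕ} [Fact ℓ.Prime] (hℓ2 : ℓ ≠ 2) (hd : discr K = -(ℓ : ℤ))
    {Wd : WeierstrassCurve ℚ} [Wd.IsElliptic] {C : VariableChange ℚ} (hC : C • W.quadraticTwist (discr K : ℚ) = Wd)
    (F : Wd.geomPoints ≃+ W.geomPoints)
    (hF : ∀ σ : absoluteGaloisGroup ℚ, (∀ P, F (σ • P) = σ • F P) ∨ (∀ P, F (σ • P) = -(σ • F P)))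
    (h1 : Nat.card (W.selmerGroup 2) = 1)
    (z : Wd.toAffine.Point) (hκ : kummerMapTorsion Wd ((2 : ℕ) : ℤ) (hdiv_two Wd) z ≠ 0)
    (hΔ : ¬ (ℓ : ℤ) ∣ minimalDiscriminantInt W) :
    geomReduction hΔ (F (toGeomPoints Wd z)) ≠ 0 := by
  have hℓ : ℓ.Prime := Fact.out
  -- the place `v₀` of `ℚ` over `ℓ`
  obtain ⟨v₀, hv₀⟩ : ∃ v : HeightOneSpectrum (𝓞 ℚ), ((primesEquiv v : Nat.Primes) : ℕ) = ℓ :=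
    ⟨primesEquiv.symm ⟨ℓ, hℓ⟩, by rw [Equiv.apply_symm_apply]⟩
  have hℓv₀ : (ℓ : 𝓞 ℚ) ∈ v₀.asIdeal := by
    rw [← hv₀]
    exact Rat.HeightOneSpectrum.natCast_natGenerator_mem v₀
  have hodd : Odd (discr K) := by
    rw [hd, odd_neg, ← Int.not_even_iff_odd, Int.even_coe_nat]
    exact fun h ↦ hℓ2 ((Nat.Prime.even_iff hℓ).mp h)
  -- the Kummer class of `z` is a non-zero Selmer class, hence non-strict at `v₀` (global half)
  have hκS : kummerMapTorsion Wd _ (hdiv_two Wd) z ∈ (Wd.kummerSelmerStructure ((2 : ℕ) : ℤ)).selmerGroup :=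
    (SetLike.ext_iff.mp (Wd.selmerGroup_eq_selmerGroup_kummerSelmerStructure _) _).mp
      (kummerMapTorsion_mem_selmerGroup Wd _ (hdiv_two Wd) _)
  have hloc := twin_selmer_localization_ne_zero_of_selmerTrivial W hΔneg hK.1 hodd hH v₀ hC
    (silent_off_of_discr_eq_neg_prime W hℓ hd hℓv₀ Wd) h1 hκS hκ
  exact geomReduction_twist_ne_zero_of_localization_ne_zero F hF hℓ2 hΔ hv₀ z hloc

/-- **The minimal discriminant is prime to `ℓ`** in the frame of `geomReduction_twist_ne_zero_of_kummer_ne_zero_of_selmerTrivial_prime`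
(so that its `hΔ` is dischargeable from the frame: the primes of `Δ_min(W) ∣ N_W^∞` split in `K`, `ℓ ∣ d_K` ramifies; the lineage's
`GenusKolyTwin.prime_discr_facts`). [cite: GrossLMS1991, §1 (p. 235)] -/
theorem not_dvd_minimalDiscriminantInt_of_discr_eq_neg_prime
    {K : Type} [Field K] [NumberField K] (hK : IsImaginaryQuadratic K)
    (hH : SatisfiesHeegnerHypothesis (W.conductorNorm ℤ) K) {ℓ : ℕ} (hℓ : ℓ.Prime) (hℓ2 : ℓ ≠ 2) (hd : discr K = -(ℓ : ℤ)) :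
    ¬ (ℓ : ℤ) ∣ minimalDiscriminantInt W := by
  have hodd : Odd (discr K) := by
    rw [hd, odd_neg, ← Int.not_even_iff_odd, Int.even_coe_nat]
    exact fun h ↦ hℓ2 ((Nat.Prime.even_iff hℓ).mp h)
  exact (GenusKolyTwin.prime_discr_facts W hK hodd hH hℓ hd).2.2

end Cell

end Summit.BirchSwinnertonDyer.BirchSwinnertonDyer.Theorems.GenusSupplyNarrow.DepthZero

end
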